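import Literature.Analysis.FluidPDE.AxisymmetricL3PressureBounds
import Literature.Analysis.FluidPDE.LocalTypeILscPressure
import Literature.Analysis.FluidPDE.PressureReconstruction
import Literature.Analysis.FunctionSpaces.SmoothParametricSetIntegral
import HarnessLib

/-!
# The ball-mean gauge of the pressure below the final time — without a Type I assumption

Analysis/FluidPDE proofs-layer file (theorems only), companion of `AxisymmetricL3Gauge` and
`AxisymmetricL3PressureBounds`. Tao's gauge `q = p − c`, `c(t) = p(t, 0) − p̃[u(t)](0)`
(`AxisymmetricL3Hyp.exists_pressure_gauge`), makes the classical pressure of the standing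
hypotheses `AxisymmetricL3Hyp ν T u p` locally `L^{3/2}` up to the final time, but `c` is only
known to be (a.e. equal to) a bounded measurable function on closed sub-slabs, so `(u, q)` is a
suitable weak solution and not obviously a classical one. When BOTH are needed of one pressure —
jointly smooth below `T` (e.g. to rescale with `IsClassicalNSSolutionOn.stRescale`) and `L^{3/2}`
on backward cylinders touching `T` (the hypothesis `q ∈ L_{3/2}(Q)` of Seregin–Šverák 2009,
Thms. 3.1–3.2) — one may gauge instead by the **ball mean** `k(t) = ⨍_{B(0,1)} p(t, y) dy`:

* `IsClassicalNSSolutionOn.sub_timeFun` — subtracting a `C^∞` function of time from the pressure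
  keeps a classical solution classical (the momentum equation only sees `∇p`);
* `IsSmoothSpaceTimeOn.contDiffOn_setAverage_ball` — ball means of a jointly smooth field are
  smooth in time on an open time set (a bump cut-off in time and the tree's
  `FunctionSpaces.contDiff_parametric_setIntegral`, differentiation under the integral sign to
  all orders over the bounded ball);
* `AxisymmetricL3Hyp.lintegral_prod_pressure_sub_ballMean_lt_top` —
  `p − k ∈ L^{3/2}((a, T) × B(x₁, r))` for `0 ≤ a`: for a.e. `t`, `p(t) − k(t) =
  p̃[u(t)] − ⨍_{B(0,1)} p̃[u(t)]` (the gauge `c(t)` is a constant in `x`, invisible to `p − ⨍ p`),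
  Jensen's inequality on the ball (`enorm_setAverage_rpow_le`) and
  `∫₀ᵀ ‖p̃[u(t)]‖_{3/2}^{3/2} dt < ∞`
  (`AxisymmetricL3Hyp.lintegral_Ioo_eLpNorm_normalisedPressure_threeHalves_rpow_lt_top`, Stein's
  bound on the Leray–Hopf slices), integrated by Tonelli's inequality.

Not here: any use of axial symmetry or boundedness on sub-slabs beyond what `AxisymmetricL3Hyp`
packages (the statements would hold verbatim for the data of `SereginSverakPressureProofs`).

## References

* T. Tao, *Localisation and compactness properties of the Navier–Stokes global regularity
  problem*, Anal. PDE 6 (2013) = arXiv:1108.1165, Lemma 4.1 (i) (pressure normalisation). [Tao2011]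
* G. Seregin, V. Šverák, Comm. Partial Differential Equations 34 (2009) 171–201 =
  arXiv:0804.1803, Thm. 3.1 (hypothesis `q ∈ L_{3/2}(Q)`). [SereginSverak2009]
-/

noncomputable section

open MeasureTheory Set Function Filter Topology TopologicalSpace Metric
open scoped NNReal ENNReal ContDiff

namespace Literature.Analysis.FluidPDE

/-! ### Subtracting a smooth function of time from a classical pressure -/

section Classical

variable {E : Type*} [NormedAddCommGroup E] [InnerProductSpace ℝ E] [FiniteDimensional ℝ E]

/-- **Classical solutions are invariant under subtracting a smooth function of time from the
pressure**: if `(u, p)` is classical on `S` (viscosity `ν`, force `f`) and `g` is `C^∞` on `S`, so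
is `(u, p − g)`: `p − g` is jointly smooth and `∇(p(t) − g(t)) = ∇p(t)` (the pressure-shift
symmetry of the system; Tao 2013, (32)). [folklore] -/
theorem IsClassicalNSSolutionOn.sub_timeFun {S : Set ℝ} {ν : ℝ} {f u : ℝ → E → E}
    {p : ℝ → E → ℝ} (h : IsClassicalNSSolutionOn S ν f u p) {g : ℝ → ℝ}
    (hg : ContDiffOn ℝ ∞ g S) :
    IsClassicalNSSolutionOn S ν f u (fun t x => p t x - g t) where
  smooth_velocity := h.smooth_velocity
  smooth_pressure := by
    have hg' : IsSmoothSpaceTimeOn S (fun t (_ : E) => g t) :=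
      hg.comp contDiffOn_fst fun z hz => (mem_prod.1 hz).1
    exact h.smooth_pressure.sub hg'
  momentum t ht x := by
    have e : gradient (fun x => p t x - g t) x = gradient (p t) x := by
      simp only [gradient, fderiv_sub_const]
    rw [e]
    exact h.momentum t ht x
  divFree := h.divFree

end Classical

/-! ### Ball means of jointly smooth fields are smooth in time -/

section BallMean

variable {Y : Type*} [NormedAddCommGroup Y] [NormedSpace ℝ Y] [FiniteDimensional ℝ Y]
  [MeasurableSpace Y] [BorelSpace Y] {μ : Measure Y} [IsFiniteMeasureOnCompacts μ]

/-- **Ball means of a jointly smooth field are smooth in time.** If `q : ℝ → Y → ℝ` is jointly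
`C^∞` on `S × Y` with `S` open (`Y` finite dimensional, `μ` finite on compact sets), then
`t ↦ ⨍_{B(x₁, ρ)} q(t, y) dμ` is `C^∞` on `S`: near `t₀ ∈ S` it is a constant multiple of the
parametric integral over the bounded ball of the globally smooth `χ(t) q(t, y)`, `χ` a bump in
time equal to `1` near `t₀` and supported in `S` (differentiation under the integral sign to all
orders, Hörmander, *ALPDO I*, Thm. 1.1.9, through the tree's
`FunctionSpaces.contDiff_parametric_setIntegral`). [folklore] -/
theorem IsSmoothSpaceTimeOn.contDiffOn_setAverage_ball {S : Set ℝ} (hS : IsOpen S)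
    {q : ℝ → Y → ℝ} (hq : IsSmoothSpaceTimeOn S q) (x₁ : Y) (ρ : ℝ) :
    ContDiffOn ℝ ∞ (fun t => ⨍ y in ball x₁ ρ, q t y ∂μ) S := by
  intro t₀ ht₀
  obtain ⟨χ, hχ⟩ := exists_contDiffBump_tsupport_subset hS ht₀
  have hqχ : ContDiff ℝ ∞ fun z : ℝ × Y => (χ : ℝ → ℝ) z.1 • q z.1 z.2 :=
    hq.contDiff_smul_of_tsupport_subset hS χ.contDiff hχ
  set H : Y × ℝ → ℝ := fun r => (χ : ℝ → ℝ) r.2 • q r.2 r.1 with hH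
  have hHs : ContDiff ℝ ∞ H := hqχ.comp (contDiff_snd.prodMk contDiff_fst)
  have hP : ContDiff ℝ ∞ fun t : ℝ => ∫ y in ball x₁ ρ, H (y, t) ∂μ :=
    FunctionSpaces.contDiff_parametric_setIntegral (μ := μ) isBounded_ball measurableSet_ball hHs
  have hP' : ContDiff ℝ ∞ fun t : ℝ => (μ.real (ball x₁ ρ))⁻¹ • ∫ y in ball x₁ ρ, H (y, t) ∂μ :=
    (contDiff_const (c := (μ.real (ball x₁ ρ))⁻¹)).smul hP
  have heq : (fun t => ⨍ y in ball x₁ ρ, q t y ∂μ) =ᶠ[𝓝 t₀]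
      fun t => (μ.real (ball x₁ ρ))⁻¹ • ∫ y in ball x₁ ρ, H (y, t) ∂μ := by
    filter_upwards [χ.eventuallyEq_one] with t ht
    rw [setAverage_eq]
    congr 1
    refine setIntegral_congr_fun measurableSet_ball fun y _ => ?_
    simp [hH, ht]
  exact ((hP'.contDiffAt).congr_of_eventuallyEq heq).contDiffWithinAt

end BallMean

/-! ### The ball-mean gauged pressure is `L^{3/2}` up to the final time -/

namespace AxisymmetricL3Hyp

variable {ν T : ℝ} {u : ℝ → EuclideanSpace ℝ (Fin 3) → EuclideanSpace ℝ (Fin 3)}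
  {p : ℝ → EuclideanSpace ℝ (Fin 3) → ℝ}

/-- **The ball-mean gauged pressure is `L^{3/2}` up to the final time.** Under the standing
hypotheses, with `k(t) = ⨍_{B(0,1)} p(t, y) dy`: for `0 ≤ a`, every centre `x₁` and every
radius `r`, `∫_{(a,T) × B(x₁, r)} |p − k|^{3/2} < ∞`. For a.e. `t ∈ (0, T)` Tao's gauge gives
`p(t) = p̃[u(t)] + c(t)` (`exists_pressure_gauge`), hence
`p(t) − k(t) = p̃[u(t)] − ⨍_{B(0,1)} p̃[u(t)]`; Jensen on the ball (`enorm_setAverage_rpow_le`)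
and `∫₀ᵀ ‖p̃[u(t)]‖_{3/2}^{3/2} dt < ∞`
(`lintegral_Ioo_eLpNorm_normalisedPressure_threeHalves_rpow_lt_top`) bound the slices by
`K ‖p̃[u(t)]‖_{3/2}^{3/2}`, and Tonelli's inequality integrates the slice bound.
[cite: Tao2011, Lemma 4.1 (i)] -/
theorem lintegral_prod_pressure_sub_ballMean_lt_top (H : AxisymmetricL3Hyp ν T u p) {a : ℝ}
    (ha : 0 ≤ a) (x₁ : EuclideanSpace ℝ (Fin 3)) (r : ℝ) :
    ∫⁻ z in Ioo a T ×ˢ ball x₁ r,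
      ‖p z.1 z.2 - ⨍ y in ball (0 : EuclideanSpace ℝ (Fin 3)) 1, p z.1 y‖ₑ ^ (3 / 2 : ℝ) < ⊤ := by
  obtain ⟨hgauge, -⟩ := H.exists_pressure_gauge
  set B : Set (EuclideanSpace ℝ (Fin 3)) := ball (0 : EuclideanSpace ℝ (Fin 3)) 1 with hB
  have hB0 : volume B ≠ 0 := (measure_ball_pos volume _ one_pos).ne'
  have hBtop : volume B ≠ ⊤ := measure_ball_lt_top.ne
  set N : ℝ → ℝ≥0∞ := fun t =>
    eLpNorm (normalisedPressure (u t)) (3 / 2 : ℝ≥0∞) volume ^ (3 / 2 : ℝ) with hN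
  set K : ℝ≥0∞ := 2 ^ ((3 / 2 : ℝ) - 1) * (1 + volume (ball x₁ r) * (volume B)⁻¹) with hK
  have h2top : (2 : ℝ≥0∞) ^ ((3 / 2 : ℝ) - 1) ≠ ⊤ :=
    ENNReal.rpow_ne_top_of_nonneg (by norm_num) (by simp)
  have hKtop : K ≠ ⊤ := ENNReal.mul_ne_top h2top (ENNReal.add_ne_top.2 ⟨by simp,
    ENNReal.mul_ne_top measure_ball_lt_top.ne (ENNReal.inv_ne_top.2 hB0)⟩)
  -- the slice bound
  have hslice : ∀ᵐ t ∂(volume.restrict (Ioo 0 T)),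
      ∫⁻ x in ball x₁ r, ‖p t x - ⨍ y in B, p t y‖ₑ ^ (3 / 2 : ℝ) ≤ K * N t := by
    filter_upwards [hgauge, ae_restrict_mem measurableSet_Ioo] with t ht htI
    set c : ℝ := p t 0 - normalisedPressure (u t) 0 with hc
    have hpt : ∀ x, p t x = normalisedPressure (u t) x + c := fun x => by rw [← ht x]; ring
    have hpc : Continuous (p t) := (H.classical.contDiff_pressure ⟨htI.1.le, htI.2⟩).continuous
    have hcont : Continuous (normalisedPressure (u t)) := by
      have e : normalisedPressure (u t) = fun x => p t x - c := funext fun x => by rw [hpt x]; ring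
      rw [e]
      exact hpc.sub continuous_const
    have hintp : IntegrableOn (p t) B volume :=
      (hpc.continuousOn.integrableOn_compact
        (isCompact_closedBall (0 : EuclideanSpace ℝ (Fin 3)) 1)).mono_set ball_subset_closedBall
    have hav : ⨍ y in B, p t y = (⨍ y in B, normalisedPressure (u t) y) + c := by
      have h1 := FunctionSpaces.setAverage_sub_const hB0 hBtop hintp c
      simp_rw [ht] at h1
      linarith
    have hsub : ∀ x, p t x - ⨍ y in B, p t y =
        normalisedPressure (u t) x - ⨍ y in B, normalisedPressure (u t) y := by
      intro x; rw [hpt x, hav]; ring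
    set A : ℝ≥0∞ := ‖⨍ y in B, normalisedPressure (u t) y‖ₑ ^ (3 / 2 : ℝ) with hA
    have hAle : A ≤ (volume B)⁻¹ * N t := by
      refine (enorm_setAverage_rpow_le hBtop (by norm_num) hcont.aestronglyMeasurable).trans ?_
      gcongr
      show _ ≤ eLpNorm (normalisedPressure (u t)) (3 / 2 : ℝ≥0∞) volume ^ (3 / 2 : ℝ)
      rw [← lintegral_enorm_rpow_threeHalves_eq_eLpNorm_rpow]
      exact setLIntegral_le_lintegral _ _
    have hpoint : ∀ x, ‖p t x - ⨍ y in B, p t y‖ₑ ^ (3 / 2 : ℝ) ≤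
        2 ^ ((3 / 2 : ℝ) - 1) * (‖normalisedPressure (u t) x‖ₑ ^ (3 / 2 : ℝ) + A) := by
      intro x
      rw [hsub x]
      refine (ENNReal.rpow_le_rpow (enorm_sub_le (E := ℝ)) (by norm_num)).trans ?_
      exact ENNReal.rpow_add_le_mul_rpow_add_rpow _ _ (by norm_num)
    calc ∫⁻ x in ball x₁ r, ‖p t x - ⨍ y in B, p t y‖ₑ ^ (3 / 2 : ℝ)
        ≤ ∫⁻ x in ball x₁ r, 2 ^ ((3 / 2 : ℝ) - 1) *
            (‖normalisedPressure (u t) x‖ₑ ^ (3 / 2 : ℝ) + A) := lintegral_mono fun x => hpoint x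
      _ = 2 ^ ((3 / 2 : ℝ) - 1) *
            ((∫⁻ x in ball x₁ r, ‖normalisedPressure (u t) x‖ₑ ^ (3 / 2 : ℝ)) +
              A * volume (ball x₁ r)) := by
          rw [lintegral_const_mul' _ _ h2top, lintegral_add_right _ measurable_const,
            setLIntegral_const]
      _ ≤ 2 ^ ((3 / 2 : ℝ) - 1) * (N t + (volume B)⁻¹ * N t * volume (ball x₁ r)) := by
          gcongr
          · show _ ≤ eLpNorm (normalisedPressure (u t)) (3 / 2 : ℝ≥0∞) volume ^ (3 / 2 : ℝ)
            rw [← lintegral_enorm_rpow_threeHalves_eq_eLpNorm_rpow]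
            exact setLIntegral_le_lintegral _ _
      _ = K * N t := by rw [hK]; ring
  -- integrate the slice bound in time (Tonelli's inequality)
  have hI : Ioo a T ⊆ Ioo 0 T := Ioo_subset_Ioo_left ha
  calc ∫⁻ z in Ioo a T ×ˢ ball x₁ r, ‖p z.1 z.2 - ⨍ y in B, p z.1 y‖ₑ ^ (3 / 2 : ℝ)
      = ∫⁻ z, ‖p z.1 z.2 - ⨍ y in B, p z.1 y‖ₑ ^ (3 / 2 : ℝ)
          ∂((volume.restrict (Ioo a T)).prod (volume.restrict (ball x₁ r))) := by
        rw [Measure.prod_restrict, ← Measure.volume_eq_prod]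
    _ ≤ ∫⁻ t in Ioo a T, ∫⁻ x in ball x₁ r, ‖p t x - ⨍ y in B, p t y‖ₑ ^ (3 / 2 : ℝ) :=
        lintegral_prod_le _
    _ ≤ ∫⁻ t in Ioo a T, K * N t :=
        lintegral_mono_ae (ae_restrict_of_ae_restrict_of_subset hI hslice)
    _ ≤ ∫⁻ t in Ioo 0 T, K * N t := lintegral_mono_set hI
    _ = K * ∫⁻ t in Ioo 0 T, N t := lintegral_const_mul' _ _ hKtop
    _ < ⊤ := ENNReal.mul_lt_top hKtop.lt_top
        H.lintegral_Ioo_eLpNorm_normalisedPressure_threeHalves_rpow_lt_top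

end AxisymmetricL3Hyp

end Literature.Analysis.FluidPDE

end
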